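/-
Copyright (c) 2026. All rights reserved.
Released under Apache 2.0 license as described in the file LICENSE.
-/
import Literature.Probability.FitznerVanDerHofstad2017.NobleBoundsN1IotaPartIII
import Literature.Probability.FitznerVanDerHofstad2017.NobleBoundsN1IotaClasses
import Literature.Probability.FitznerVanDerHofstad2017.NobleBoundsN1Class01
import HarnessLib

/-!
# Fitzner–van der Hofstad (2017), §6.1 for `Ξ^{(1),ι}` — the `F^{ι,III}_0` part discharged in every class; the
interface of (lemmapercboundXiiota1-1-step0) reduced to the `F^{ι,I}_0 ∪ F^{ι,II}_0` part

[FvdH17] = R. Fitzner, R. van der Hofstad, *Mean-field behavior for nearest-neighbor percolation in `d > 10`*,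
Electron. J. Probab. **22** (2017), no. 43; extended version arXiv:1506.07977v2: §6.1, proof of Lemma 5.3
(pp. 59–60), display (lemmapercboundXiiota1-1-step0)
`Ξ^{(1),ι}_p(x) ≤ Σ_{a,b=0}^{2} Σ_{u,κ,w,z,t} (δ_{a,0} δ_{ι,κ} 𝟙{u=w=0} + P^{ι,a}(u,w)) Ā^{κ,a,b}(u,w,t,z) P^{E,b}(t−x,z−x)`
and the sentence "If `F^{ι,III}_0` occurs, then we have `w = u = 0` and `κ = ι`" (p. 59); Lemma 5.3, first
display (BoundXiIotaOne-1) `Σ_x Ξ^{(1),ι}_p(x) ≤ P⃗^ι Ā^ι P⃗^E` (p. 50); (3.55) (p. 30) and (4.70) (p. 45) for the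
two parts of `Ξ^{(N),ι}`.

## What this module provides (kernel-checked; nothing here is a cited hypothesis; `d`-generic; no numeral)

The interface theorem `nobleXiIotaT_one_le_blocks_of_cls` (`NobleBoundsN1IotaClasses`) takes three inputs:
`h1` — a two-level bound on `Ξ^{(1),ι}` by a bond-summed event family `E(u,v,w,z,t)` (the `F^{ι,I}_0 ∪ F^{ι,II}_0`
part, i.e. `Ξ^{b_ι,(1)}(0,x;{e_ι})`) plus an event family `E₃(z,t)` (the `F^{ι,III}_0` part); `h2` — one estimate
per length class `(a,b)` of `E`; `h3` — one estimate per class `b` of `E₃`.  `NobleBoundsN1IotaPartIII`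
discharged the `E₃`-half of `h1` with `E₃ = jointWitIII ι · · x` (`nobleXiIotaT_one_le_add_partIII`) and `h3` for
`b = 0, 2` (`jointWitIII_cls_zero`, `jointWitIII_cls_two`), recording that `b = 1` "is the same one-liner once the
class `(0,1)` module is in the tree".  That module is in the tree (`NobleBoundsN1Class01.jointWit_cls_0_1`), so:

* `jointWitIII_cls_one` — `h3` for `b = 1`; `jointWitIII_cls` — `h3` for every class `b`;
* **`nobleXiIotaT_one_le_blocks_of_cls₁₂`** — the interface with the `F^{ι,III}_0` part FULLY discharged: from
  an event family `E(u,v,w,z,t)` with `Ξ^{b_ι,(1)}(0,x;{e_ι}) ≤ Σ_{(u,v)} Σ_{w,z,t} J(v−u) ℙ_p^{⊗2}(E(u,v,w,z,t))`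
  (`h1'`, parts `I ∪ II` only) and its nine class estimates `h2` against `P^{ι,a} = blockPiota (Letters.perc d p) ι a`,
  conclude (lemmapercboundXiiota1-1-step0) with the primed middle element `Ā' = blockAbar'` (`NobleBlocksPrime`);
* `tsum_ofReal_nobleXiIotaN_one_le_of_cls₁₂` — the summed form (BoundXiIotaOne-1) on the primed element
  `P⃗^ι (Ā^ι)' P⃗^E` for the real coefficient `nobleXiIotaN d p (e_{ι₀}) 1`, from the same two inputs supplied
  for every direction `ι` and every `x` (`NobleBlocks.tsum_ofReal_nobleXiIotaN_le_vecPiota_matAbarIota'_vecPE`,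
  whose `ι`-average is removed by the lattice symmetry inside that lemma), and the `ι`-averaged `[0,∞]` form
  `invTwoD_mul_sum_tsum_nobleXiIotaT_one_le_of_cls₁₂` (no symmetry needed).

What remains open for a hypothesis-free (BoundXiIotaOne-1) at `N = 1` is therefore exactly the parts-`I ∪ II`
input: the joint two-level event of `Ξ^{b_ι,(1)}(0,x;{e_ι})` with its bond-summed bound (`h1'`) and its nine class
estimates (`h2`) — whose level-`0` "start" factors are the row inequalities
`NobleBoundsN1IotaStart.piPerc_iotaStart_*_le_blockPiota`, and whose middle and end factors are the `Ξ^{(1)}`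
lemmas of `NobleBoundsN1ClassTools` / `NobleBoundsN1Cls*` by name.  No named fact, no numeral, no dimension.
-/

noncomputable section

namespace Literature.Probability.FitznerVanDerHofstad2017

open _root_.MeasureTheory Literature.Barriers.CriticalPhenomena Literature.Probability.Percolation
open Literature.Probability.LatticeModels _root_.SimpleGraph
open Literature.Probability.FitznerVanDerHofstad2017.NobleBlocks
open scoped ENNReal Matrix

variable {d : ℕ}

/-! ### A. `h3` in every class -/

/-- **`h3`, class `b = 1`** (the last line is the open bond `(t,z)`), from `NobleBoundsN1Class01.jointWit_cls_0_1`
at `(u,v,w) = (0,e_ι,0)`: `ℙ_p^{⊗2}(jointWitIII ∩ class 1) ≤ Ā'^{ι,0,1}(0,0,t,z) P^{E,1}(t−x,z−x)`.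
[cite: FitznerVanDerHofstad2017, §6.1 proof of Lemma 5.3, "If F^{ι,III}_0 occurs, then we have w=u=0 and κ=ι"; "Case a = 0", "b = 1" (arXiv:1506.07977v2 p. 59)] -/
theorem jointWitIII_cls_one (p : unitInterval) (ι : Fin d × Bool) (x z t : Site d) :
    piPerc d p 2 (jointWitIII ι z t x ∩ lineCls t z 1 1) ≤
      blockAbar' (Letters.perc d p) ι 0 1 0 0 t z * blockPE (Letters.perc d p) 1 (t - x) (z - x) :=
  jointWitIII_cls_of p ι x z t 1 (jointWit_cls_0_1 p x 0 (stepVec ι) 0 z t)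

/-- **`h3` of `nobleXiIotaT_one_le_blocks_of_cls` for `E₃ = jointWitIII ι · · x`, every class `b ∈ {0,1,2}`**:
`ℙ_p^{⊗2}(jointWitIII ∩ class b) ≤ Ā'^{ι,0,b}(0,0,t,z) P^{E,b}(t−x,z−x)`.
[cite: FitznerVanDerHofstad2017, §6.1 proof of Lemma 5.3, "If F^{ι,III}_0 occurs, then we have w=u=0 and κ=ι" (arXiv:1506.07977v2 p. 59)] -/
theorem jointWitIII_cls (p : unitInterval) (ι : Fin d × Bool) (x : Site d) :
    ∀ (b : Fin 3) (z t : Site d), piPerc d p 2 (jointWitIII ι z t x ∩ lineCls t z 1 b) ≤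
      blockAbar' (Letters.perc d p) ι 0 b 0 0 t z * blockPE (Letters.perc d p) b (t - x) (z - x) := by
  intro b z t
  fin_cases b
  exacts [jointWitIII_cls_zero p ι x z t, jointWitIII_cls_one p ι x z t, jointWitIII_cls_two p ι x z t]

/-! ### B. The interface reduced to the `F^{ι,I}_0 ∪ F^{ι,II}_0` part -/

/-- **(lemmapercboundXiiota1-1-step0) from the parts-`I ∪ II` input alone.**  Let `E(u,v,w,z,t)` be a two-level
event family with `Ξ^{b_ι,(1)}(0,x;{e_ι}) ≤ Σ_{(u,v)} Σ_{w,z,t} J(v−u) ℙ_p^{⊗2}(E(u,v,w,z,t))` and suppose, for every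
class `(a,b)`, `J(v−u) ℙ_p^{⊗2}(E ∩ class (a,b)) ≤ Σ_κ 𝟙{v = u + e_κ} P^{ι,a}(u,w) Ā'^{κ,a,b}(u,w,t,z) P^{E,b}(t−x,z−x)`.
Then `Ξ^{(1),ι}_p(x) ≤ Σ_{u,w,t,z} Σ_{κ,a,b} (δ_{a,0} δ_{ι,κ} 𝟙{u=w=0} + P^{ι,a}(u,w)) Ā'^{κ,a,b}(u,w,t,z) P^{E,b}(t−x,z−x)`
for the percolation letters `Letters.perc d p` — the `F^{ι,III}_0` part being supplied by
`nobleXiIotaT_one_le_add_partIII` and `jointWitIII_cls`.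
[cite: FitznerVanDerHofstad2017, §6.1 proof of Lemma 5.3, display (lemmapercboundXiiota1-1-step0) (arXiv:1506.07977v2 p. 59); (3.55) (p. 30)] -/
theorem nobleXiIotaT_one_le_blocks_of_cls₁₂ (p : unitInterval) (ι : Fin d × Bool) (x : Site d)
    (E : Site d → Site d → Site d → Site d → Site d → Set (Fin 2 → BondConfig (Site d)))
    (h1 : nobleXiBT d p {s(0, stepVec ι)} ∅ 1 {stepVec ι} 0 x ≤
      ∑' b : Site d × Site d, ∑' w : Site d, ∑' z : Site d, ∑' t : Site d,
        ENNReal.ofReal (bondJ d p (b.2 - b.1)) * piPerc d p 2 (E b.1 b.2 w z t))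
    (h2 : ∀ (a b : Fin 3) (u v w z t : Site d),
      ENNReal.ofReal (bondJ d p (v - u)) * piPerc d p 2 (E u v w z t ∩ clsSet u w t z a b) ≤
        ∑ κ : Fin d × Bool, (if v = u + stepVec κ then (1 : ℝ≥0∞) else 0) *
          (blockPiota (Letters.perc d p) ι a u w * blockAbar' (Letters.perc d p) κ a b u w t z *
            blockPE (Letters.perc d p) b (t - x) (z - x))) :
    nobleXiIotaT d p (stepVec ι) 1 x ≤ ∑' u, ∑' w, ∑' t, ∑' z, ∑ κ : Fin d × Bool, ∑ a : Fin 3, ∑ b : Fin 3,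
      (kdeltaPref ι κ a u w + blockPiota (Letters.perc d p) ι a u w) *
        blockAbar' (Letters.perc d p) κ a b u w t z * blockPE (Letters.perc d p) b (t - x) (z - x) :=
  nobleXiIotaT_one_le_blocks_of_cls (Letters.perc d p) p ι x E (fun z t => jointWitIII ι z t x)
    ((nobleXiIotaT_one_le_add_partIII p ι x).trans (add_le_add h1 le_rfl)) h2 (jointWitIII_cls p ι x)

/-! ### C. The summed forms (BoundXiIotaOne-1) from the parts-`I ∪ II` input -/

/-- **(BoundXiIotaOne-1), `ι`-averaged, in `[0,∞]`**: if for every direction `ι` and every `x` the parts-`I ∪ II`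
input of `nobleXiIotaT_one_le_blocks_of_cls₁₂` is available, then
`(1/2d) Σ_ι Σ_x Ξ^{(1),ι}_T(x) ≤ P⃗^ι (Ā^ι)' P⃗^E` on the percolation letters.
[cite: FitznerVanDerHofstad2017, Lemma 5.3 (BoundXiIotaOne-1) (arXiv:1506.07977v2 p. 50); §6.1 "the bound follows by repeating the steps leading to (6.5)" (p. 59); §5.1 `(P⃗^ι)_b` (p. 49)] -/
theorem invTwoD_mul_sum_tsum_nobleXiIotaT_one_le_of_cls₁₂ (p : unitInterval)
    (E : Fin d × Bool → Site d → Site d → Site d → Site d → Site d → Site d → Set (Fin 2 → BondConfig (Site d)))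
    (h1 : ∀ (ι : Fin d × Bool) (x : Site d), nobleXiBT d p {s(0, stepVec ι)} ∅ 1 {stepVec ι} 0 x ≤
      ∑' b : Site d × Site d, ∑' w : Site d, ∑' z : Site d, ∑' t : Site d,
        ENNReal.ofReal (bondJ d p (b.2 - b.1)) * piPerc d p 2 (E ι x b.1 b.2 w z t))
    (h2 : ∀ (ι : Fin d × Bool) (x : Site d) (a b : Fin 3) (u v w z t : Site d),
      ENNReal.ofReal (bondJ d p (v - u)) * piPerc d p 2 (E ι x u v w z t ∩ clsSet u w t z a b) ≤
        ∑ κ : Fin d × Bool, (if v = u + stepVec κ then (1 : ℝ≥0∞) else 0) *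
          (blockPiota (Letters.perc d p) ι a u w * blockAbar' (Letters.perc d p) κ a b u w t z *
            blockPE (Letters.perc d p) b (t - x) (z - x))) :
    invTwoD d * ∑ ι : Fin d × Bool, ∑' x, nobleXiIotaT d p (stepVec ι) 1 x ≤
      vecPiota (Letters.perc d p) ᵥ* matAbarIota' (Letters.perc d p) ⬝ᵥ vecPE (Letters.perc d p) :=
  invTwoD_mul_sum_tsum_le_vecPiota_matAbarIota'_vecPE (Letters.perc d p)
    (fun ι x => nobleXiIotaT d p (stepVec ι) 1 x)
    fun ι x => nobleXiIotaT_one_le_blocks_of_cls₁₂ p ι x (E ι x) (h1 ι x) (h2 ι x)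

/-- **(BoundXiIotaOne-1) = Lemma 5.3, first display, on the primed element, for the real coefficient
`Ξ^{(1),ι₀}_p = nobleXiIotaN d p e_{ι₀} 1`** (every fixed direction `ι₀`; `ofReal ∘ toReal ≤ id`, and the
`ι`-average removed by the lattice symmetry): from the parts-`I ∪ II` input for every `ι` and `x`,
`Σ_x Ξ^{(1),ι₀}_p(x) ≤ P⃗^ι (Ā^ι)' P⃗^E` on the percolation letters.
[cite: FitznerVanDerHofstad2017, Lemma 5.3 (BoundXiIotaOne-1) (arXiv:1506.07977v2 p. 50); §6.1 (p. 59); §3.5 (p. 30)] -/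
theorem tsum_ofReal_nobleXiIotaN_one_le_of_cls₁₂ (p : unitInterval)
    (E : Fin d × Bool → Site d → Site d → Site d → Site d → Site d → Site d → Set (Fin 2 → BondConfig (Site d)))
    (h1 : ∀ (ι : Fin d × Bool) (x : Site d), nobleXiBT d p {s(0, stepVec ι)} ∅ 1 {stepVec ι} 0 x ≤
      ∑' b : Site d × Site d, ∑' w : Site d, ∑' z : Site d, ∑' t : Site d,
        ENNReal.ofReal (bondJ d p (b.2 - b.1)) * piPerc d p 2 (E ι x b.1 b.2 w z t))
    (h2 : ∀ (ι : Fin d × Bool) (x : Site d) (a b : Fin 3) (u v w z t : Site d),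
      ENNReal.ofReal (bondJ d p (v - u)) * piPerc d p 2 (E ι x u v w z t ∩ clsSet u w t z a b) ≤
        ∑ κ : Fin d × Bool, (if v = u + stepVec κ then (1 : ℝ≥0∞) else 0) *
          (blockPiota (Letters.perc d p) ι a u w * blockAbar' (Letters.perc d p) κ a b u w t z *
            blockPE (Letters.perc d p) b (t - x) (z - x)))
    (ι₀ : Fin d × Bool) :
    ∑' x, ENNReal.ofReal (nobleXiIotaN d p (stepVec ι₀) 1 x) ≤
      vecPiota (Letters.perc d p) ᵥ* matAbarIota' (Letters.perc d p) ⬝ᵥ vecPE (Letters.perc d p) :=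
  tsum_ofReal_nobleXiIotaN_le_vecPiota_matAbarIota'_vecPE (Letters.perc d p) p 1
    (fun ι x => ENNReal.ofReal_toReal_le.trans
      (nobleXiIotaT_one_le_blocks_of_cls₁₂ p ι x (E ι x) (h1 ι x) (h2 ι x))) ι₀

end Literature.Probability.FitznerVanDerHofstad2017

end
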